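import Summits.Ventures.PercRepro.RankLevelSetExplicitLin2CoreMult
import Summits.Ventures.PercRepro.RankLevelSetExplicitLin2KeyG
import Summits.Ventures.PercRepro.RankLevelSetDepCountMultCube
import Summits.Ventures.PercRepro.S2MultWeightSums

/-!
# PercRepro — THE CUBIC KEY OF `(P_d)`: THE CORE CELL AND THE LEVEL FROM ONE CUBIC ROW (p9, S4; p4's lever)

`proofs/SUBCLAIM-S4-p9.md` §S4.2⁗‴. p4's cubic multiplicity (S2CubeMultiplicity, `card_spanF_ge_cube`): every rank-`q` set of
`m` elements of a matroid with every circuit `≥ 3` and every rank-`2` set `≤ 3` points contains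
`≥ cube(m − q) = (m − q) + 3·C(m − q, 2) + 3·C(m − q, 3)` pairs, so night-1's level count holds with `cube(m − q)` for `m − q`
(`Matroid.ncard_eRk_eq_ncard_eq_mul_le_cube`, RankLevelSetDepCountMultCube) and the class weights become
`Σ_j C(μ − 1, j)/cube(j + 1) ≤ 24·2^μ/(μ(μ+1)(μ+2))` (`S2.sum_range_choose_div_cube_le`, S2MultWeightSums). The cubic key
`KeyC q p d` is the generic key `KeyG` with the certificate `cs = cb = 24`, `Ds = μ_s(μ_s+1)(μ_s+2)`, `Db = μ_b(μ_b+1)(μ_b+2)`;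
`c025_core_lin2_of_keyC` closes the `e`-free core cell from it (`c025_core_lin2_of_poly_mult` with the cubic count and
weights) and `c025_level_succ_of_keyC_row` gives the level from one evaluated cubic row (`c025_level_succ_of_key_row`).
The rows (`decide` at the cubic floors `3,294 / 6,833 / 14,173 / …` at `q = 10 / 11 / 12 / …`, against the saturated
`8,710 / 18,780 / 40,204 / …`) are the modules RankLevelSetExplicitLin2CubeRowTen, … . Axioms: standard.
-/

open scoped Matroid

namespace PercRepro

namespace ThmN

namespace Explicit

/-- `μ(μ+1)(μ+2)` — the denominator of the cubic weight certificate. -/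
abbrev Pc (μ : ℕ) : ℕ := μ * (μ + 1) * (μ + 2)

/-- The cubic multiplicity `cube(v) = v + 3·C(v, 2) + 3·C(v, 3)` (`= v(v² + 1)/2`). -/
abbrev cubeMult (v : ℕ) : ℕ := v + 3 * v.choose 2 + 3 * v.choose 3

/-- **THE CUBIC KEY**: `KeyG` with the cubic certificate `W·μ(μ+1)(μ+2) ≤ 24·2^μ` in both classes. -/
abbrev KeyC (q p d : ℕ) : Prop :=
  KeyG q p d 24 (Pc (min (5 * 2 ^ (q - 4) - q) d)) 24 (Pc (min (5 * 2 ^ (q - 3) - q - 1) d))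

/-- `KeyC` is monotone in the rank (`q ≤ d`). -/
theorem keyC_succ (q p d : ℕ) (hd : q ≤ d) (h : KeyC q p d) : KeyC q (p + 1) d :=
  keyG_succ q p d _ _ _ _ hd h

/-- `KeyC` at `p₀` gives `KeyC` at every `p ≥ p₀` (`q ≤ d`). -/
theorem keyC_mono (q d p₀ p : ℕ) (hd : q ≤ d) (hp : p₀ ≤ p) (h : KeyC q p₀ d) : KeyC q p d :=
  keyG_mono q d _ _ _ _ p₀ p hd hp h

/-- **THE CUBIC WEIGHT BOUND**: `(Σ_{j < N} C(μ − 1, j)/cube(j + 1))·μ(μ+1)(μ+2) ≤ 24·2^μ` for `μ ≥ 1`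
(`S2.sum_range_choose_div_cube_le` at `F = μ − 1`). -/
theorem cube_weight_bound (μ N : ℕ) (hμ : 1 ≤ μ) :
    (∑ j ∈ Finset.range N, (((μ - 1).choose j : ℕ) : ℚ) / ((cubeMult (j + 1) : ℕ) : ℚ)) * ((Pc μ : ℕ) : ℚ) ≤
      ((24 : ℕ) : ℚ) * 2 ^ μ := by
  have h := S2.sum_range_choose_div_cube_le (μ - 1) N
  rw [show μ - 1 + 1 = μ by omega, show μ - 1 + 2 = μ + 1 by omega, show μ - 1 + 3 = μ + 2 by omega] at h
  have hpos : (0 : ℚ) < ((Pc μ : ℕ) : ℚ) := by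
    have : 0 < Pc μ := by unfold Pc; positivity
    exact_mod_cast this
  have h' : ∑ j ∈ Finset.range N, (((μ - 1).choose j : ℕ) : ℚ) / ((cubeMult (j + 1) : ℕ) : ℚ) ≤
      24 * 2 ^ μ / ((Pc μ : ℕ) : ℚ) := h
  rw [le_div_iff₀ hpos] at h'
  rw [show ((24 : ℕ) : ℚ) = 24 by norm_num]
  exact h'

end Explicit

variable {α : Type}

/-- **THE CORE CELL FROM ITS CUBIC KEY**: the `e`-free core at level `q ≥ 8`, corank `q + 1 ≤ d ≤ q + 2^q`, rank
`p ≥ 2d + 3q + 5`, satisfies `RLS M p q` once `KeyC q p d` holds (`c025_core_lin2_of_poly_mult` with the cubic level count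
`ncard_eRk_eq_ncard_eq_mul_le_cube` and the cubic weight bound through `poly_of_keyG`). -/
theorem c025_core_lin2_of_keyC (q : ℕ) (hq : 8 ≤ q) (M : Matroid α) [M.Finite] (p d : ℕ)
    (hd1 : q + 1 ≤ d) (hd2 : d ≤ q + 2 ^ q) (htail : 2 * d + 3 * q + 5 ≤ p) (hkey : Explicit.KeyC q p d)
    (hR : M.eRank = (p : ℕ∞)) (hn : M.E.ncard = p + d)
    (hfree : ∀ e ∈ M.E, ∃ A ⊆ M.E \ {e}, e ∉ M.closure A ∧ e ∉ M.closure ((M.E \ {e}) \ A)) :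
    RLS M p q := by
  have hx := Explicit.le_two_pow_sub_four q (by omega)
  obtain ⟨-, -, hq3, h23⟩ := Explicit.two_pow_facts2 q hq
  have hμs1 : 1 ≤ min (5 * 2 ^ (q - 4) - q) d := le_min (by omega) (by omega)
  have hμb1 : 1 ≤ min (5 * 2 ^ (q - 3) - q - 1) d := le_min (by omega) (by omega)
  refine c025_core_lin2_of_poly_mult q hq M p d hd1 hd2 htail Explicit.cubeMult
    (fun v hv => by unfold Explicit.cubeMult; omega)
    (fun f f' hcirc hC1 _ hflat hflat' hd m =>
      Matroid.ncard_eRk_eq_ncard_eq_mul_le_cube M q f f' (by omega) hcirc hC1 hflat hflat' hd m)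
    (fun A B Ws Wb hWs hWb hA hB => ?_) hR hn hfree
  have hDs : 0 < Explicit.Pc (min (5 * 2 ^ (q - 4) - q) d) := by unfold Explicit.Pc; positivity
  have hDb : 0 < Explicit.Pc (min (5 * 2 ^ (q - 3) - q - 1) d) := by unfold Explicit.Pc; positivity
  refine Explicit.poly_of_keyG q p d 24 _ 24 _ hDs hDb hkey A B Ws Wb ?_ ?_ hA hB
  · rw [hWs]; exact Explicit.cube_weight_bound _ (d - q) hμs1
  · rw [hWb]; exact Explicit.cube_weight_bound _ (d - q) hμb1

/-- **THE LEVEL FROM ONE EVALUATED CUBIC ROW**: level `q + 1 ≥ 8` for every finite matroid and every `p ≥ p₀` from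
level `q` for every `p ≥ p₀ − 1`, the cubic key row `KeyC (q + 1) p₀ d` at every core corank `q + 2 ≤ d ≤ q + 1 + 2^{q+1}`,
`p₀ ≥ N₁(q + 1)` and the tail `2(q + 1 + 2^{q+1}) + 3(q + 1) + 5 ≤ p₀` (`c025_level_succ_of_key_row`). -/
theorem c025_level_succ_of_keyC_row (q : ℕ) (hq : 7 ≤ q) (p₀ : ℕ)
    (hN : 2 ^ (q + 1 + 1) + 2 * (q + 1) ^ 2 + 4 * (q + 1) + 4 ≤ p₀)
    (htail : 2 * (q + 1 + 2 ^ (q + 1)) + 3 * (q + 1) + 5 ≤ p₀)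
    (hrow : ∀ t < 2 ^ (q + 1), Explicit.KeyC (q + 1) p₀ (q + 2 + t))
    (hprev : ∀ (M : Matroid α) [M.Finite] (p : ℕ), p₀ - 1 ≤ p → RLS M p q) :
    ∀ (M : Matroid α) [M.Finite] (p : ℕ), p₀ ≤ p → RLS M p (q + 1) :=
  c025_level_succ_of_key_row q hq p₀ (Explicit.KeyC (q + 1)) hN htail
    (fun p d hd h => Explicit.keyC_succ (q + 1) p d hd h)
    (fun M _ p d hd1 hd2 ht hk hR hn hfree => c025_core_lin2_of_keyC (q + 1) (by omega) M p d hd1 hd2 ht hk hR hn hfree)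
    hrow hprev

end ThmN

end PercRepro
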